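import Literature.Topology.FourManifolds.LefschetzBasePages
import Literature.Topology.Euclidean.InvarianceOfDomain
import Literature.Topology.PlaneTopology.WindingNumber
import Summits.SmoothPoincare4.SmoothPoincare4.Theorems.ConvexBisectionAcyclicBisectionExistsPageTwistingTransverse
import Mathlib.Analysis.Calculus.Implicit
import HarnessLib

/-!
# Annulus charts in a page of the Lefschetz base: relative openness and path lifting
(wave 2, brick N1a = (M3c) "Picard–Lefschetz on shadows" of stub `stub_modelsOnFibred_of_reach`
= NF4 `Literature.Topology.FourManifolds.LefschetzBase.modelsOnFibred_of_reach`, line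
`modp-braid-orbits`, crux `ConvexBisection.AcyclicBisectionExists`, item stmt-SmoothPoincare4-10508;
registered sub-goal `helper_annulusChart_lift`; file 1 of the Picard–Lefschetz bricks)

The page Dehn twist of node N1a (`NF4_Design.lean`) is presented in an ANNULUS CHART
`φ : ℝ × ℝ → Base g` of a page `page g c` (`LefschetzBasePages.lean` §5): continuous, `1`-periodic
in the first variable, injective on `[0, 1) × (−1, 1)`, with values in the page.  The homological
computation of the twist (files 2–3) cuts a loop of the page into pieces inside / outside the open
annulus `A = φ(ℝ × (−1, 1))` and LIFTS the inside pieces through `φ`.  This file supplies the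
point-set topology of such a chart, from the hypotheses of the node alone:

* §1 `chart_periodic_int`, `chart_eq_iff` — integer periodicity; two points of `ℝ × (−1, 1)` with
  the same image have the same height and abscissae differing by an integer;
* §2 **`chart_relOpen`** — `φ` is RELATIVELY OPEN into the page at every point of `ℝ × (−1, 1)`:
  the image of a neighbourhood contains the trace on the page of a neighbourhood in `Base g`.
  Proof: the page `{‖x‖² < 4, w = c/2}` is a level set of the submersion `w : ℝ⁴ → ℂ`
  (`fderiv_w_apply`, `dPhiX_ne_zero_or`; `(x, y) ≠ 0` on a page), so the implicit function chart
  `Θ : ℝ⁴ ≃ ℂ × ker dw` (`HasStrictFDerivAt.implicitToOpenPartialHomeomorph`) straightens it onto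
  the plane `ker dw ≅ ℝ²`; there `Θ ∘ φ` is a continuous injection of an open subset of `ℝ²`, hence
  open by Brouwer's invariance of domain (`Literature.Topology.Euclidean.Brouwer.isOpen_image_of_injOn`);
* §3 `isOpen_preimage_annulus` — the open annulus pulls back to an open set under every continuous
  map into the page; **`exists_chart_lift` / `helper_annulusChart_lift`** — a path of the open
  annulus lifts continuously through `φ` to `ℝ × (−1, 1)` (continuity of the multivalued inverse
  read through `(u, r) ↦ exp (r + 2πiu)`, then a continuous logarithm, `hasLogOn_Icc`).

Everything is proved; no named facts, no `sorry`.  References: A. Hatcher, *Algebraic Topology*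
(2002), §1.3 (lifting) [HatcherAT2002]; T. Tao, *Hilbert's fifth problem and related topics* (2014),
Thm. 6.0.12 (invariance of domain) [Tao2014].
-/

noncomputable section

set_option linter.dupNamespace false

open scoped Manifold ContDiff Topology Real
open Set Function Metric Filter
open Literature.Topology.FourManifolds Literature.Topology.FourManifolds.LefschetzBase

namespace Summit.SmoothPoincare4.SmoothPoincare4.Theorems.AcyclicBisectionExists.ModpBraidOrbits

variable {g : ℕ} {c : ℂ} {φ : ℝ × ℝ → Base g}

/-! ## §1 Periodicity and injectivity up to the period -/

/-- A map `1`-periodic in the first variable is `ℤ`-periodic in it. [folklore] -/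
theorem chart_periodic_int (hφ1 : ∀ u r, φ (u + 1, r) = φ (u, r)) (n : ℤ) (u r : ℝ) :
    φ (u + n, r) = φ (u, r) := by
  induction n using Int.induction_on generalizing u with
  | zero => simp
  | succ k ih =>
    have h := hφ1 (u + k) r
    rw [add_assoc] at h
    have h' := ih u
    push_cast at h' ⊢
    rw [h, h']
  | pred k ih =>
    have h := hφ1 (u + (-(k : ℝ) - 1)) r
    rw [add_assoc, show -(k : ℝ) - 1 + 1 = -(k : ℝ) by ring] at h
    have h' := ih u
    push_cast at h' ⊢
    rw [← h, h']

/-- Reduction of the abscissa modulo `1`. [folklore] -/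
theorem chart_fract (hφ1 : ∀ u r, φ (u + 1, r) = φ (u, r)) (p : ℝ × ℝ) :
    φ (Int.fract p.1, p.2) = φ p := by
  have h := chart_periodic_int hφ1 (-⌊p.1⌋) p.1 p.2
  rw [Int.fract, sub_eq_add_neg, ← Int.cast_neg, h]

/-- **Injectivity up to the period**: two points of `ℝ × (−1, 1)` with the same image under an
annulus chart have the same height and abscissae differing by an integer. [folklore] -/
theorem chart_eq_iff (hφ1 : ∀ u r, φ (u + 1, r) = φ (u, r))
    (hφi : InjOn φ (Ico (0 : ℝ) 1 ×ˢ Ioo (-1 : ℝ) 1)) {p p' : ℝ × ℝ}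
    (hp : p.2 ∈ Ioo (-1 : ℝ) 1) (hp' : p'.2 ∈ Ioo (-1 : ℝ) 1) (h : φ p = φ p') :
    p.2 = p'.2 ∧ ∃ n : ℤ, p'.1 = p.1 + n := by
  have e := hφi (⟨⟨Int.fract_nonneg _, Int.fract_lt_one _⟩, hp⟩ :
      (Int.fract p.1, p.2) ∈ Ico (0 : ℝ) 1 ×ˢ Ioo (-1 : ℝ) 1)
    (⟨⟨Int.fract_nonneg _, Int.fract_lt_one _⟩, hp'⟩ :
      (Int.fract p'.1, p'.2) ∈ Ico (0 : ℝ) 1 ×ˢ Ioo (-1 : ℝ) 1)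
    (by rw [chart_fract hφ1, chart_fract hφ1, h])
  simp only [Prod.mk.injEq] at e
  refine ⟨e.2, ⌊p'.1⌋ - ⌊p.1⌋, ?_⟩
  have h1 := Int.fract_add_floor p.1
  have h2 := Int.fract_add_floor p'.1
  push_cast
  linarith [e.1]

/-- Injectivity on a window of width one. [folklore] -/
theorem chart_injOn_window (hφ1 : ∀ u r, φ (u + 1, r) = φ (u, r))
    (hφi : InjOn φ (Ico (0 : ℝ) 1 ×ˢ Ioo (-1 : ℝ) 1)) (u₀ : ℝ) :
    InjOn φ (Ioo (u₀ - 1 / 2) (u₀ + 1 / 2) ×ˢ Ioo (-1 : ℝ) 1) := by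
  rintro p ⟨hp1, hp2⟩ p' ⟨hp1', hp2'⟩ h
  obtain ⟨h2, n, hn⟩ := chart_eq_iff hφ1 hφi hp2 hp2' h
  have hlt : |(n : ℝ)| < 1 := by
    rw [abs_lt]; constructor <;> linarith [hp1.1, hp1.2, hp1'.1, hp1'.2]
  have hn0 : n = 0 := by
    have : |n| < 1 := by exact_mod_cast hlt
    exact Int.abs_lt_one_iff.1 this
  subst hn0
  simp only [Int.cast_zero, add_zero] at hn
  exact Prod.ext hn.symm h2

/-! ## §2 The chart is relatively open in the page -/

/-- A point of a page of unit direction is not the origin of `ℂ²` (there `w = −1`, of norm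
`1 ≠ 1/2`). [folklore] -/
theorem page_val_ne_zero (hc : ‖c‖ = 1) {q : Base g} (hq : q ∈ page g c) : q.1 ≠ 0 := by
  intro h0
  have hw : w g q.1 = c / 2 := hq.2
  rw [h0] at hw
  have hx : cx (0 : EuclideanSpace ℝ (Fin 4)) = 0 := Complex.ext rfl rfl
  have hy : cy (0 : EuclideanSpace ℝ (Fin 4)) = 0 := Complex.ext rfl rfl
  have h1 : w g (0 : EuclideanSpace ℝ (Fin 4)) = -1 := by
    simp [w, Phi, hx, hy]
  rw [h1] at hw
  have := congrArg norm hw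
  rw [norm_neg, norm_one, norm_div, hc] at this
  norm_num at this

/-- **The differential of `w` is onto `ℂ` away from the origin** (`dw(v) = a x_v + b y_v` with
`(a, b) ≠ 0`). [folklore] -/
theorem fderiv_w_surjective {q : EuclideanSpace ℝ (Fin 4)} (hq : q ≠ 0) :
    Function.Surjective (fderiv ℝ (w g) q) := by
  intro z
  rcases dPhiX_ne_zero_or (g := g) hq with h | h
  · refine ⟨mk (z / dPhiX g q) 0, ?_⟩
    rw [fderiv_w_apply, cx_mk, cy_mk]; field_simp; ring
  · refine ⟨mk 0 (z / dPhiY q), ?_⟩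
    rw [fderiv_w_apply, cx_mk, cy_mk]; field_simp; ring

/-- The kernel of a surjective real-linear map `ℝ⁴ → ℂ` is a plane. [folklore] -/
theorem finrank_ker_eq_two {f' : EuclideanSpace ℝ (Fin 4) →L[ℝ] ℂ}
    (hf' : LinearMap.range (f' : EuclideanSpace ℝ (Fin 4) →ₗ[ℝ] ℂ) = ⊤) :
    Module.finrank ℝ (LinearMap.ker (f' : EuclideanSpace ℝ (Fin 4) →ₗ[ℝ] ℂ)) = 2 := by
  have hrk := LinearMap.finrank_range_add_finrank_ker (f' : EuclideanSpace ℝ (Fin 4) →ₗ[ℝ] ℂ)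
  rw [hf', finrank_top, Complex.finrank_real_complex, finrank_euclideanSpace_fin] at hrk
  omega

/-- **An annulus chart is relatively open into its page**: for `p₀ ∈ ℝ × (−1, 1)` and every
neighbourhood `N` of `p₀`, some neighbourhood `O` of `φ p₀` in `Base g` has its trace on the page
inside `φ '' N` (implicit function chart of the page + invariance of domain).
[cite: Tao2014, Thm. 6.0.12] -/
theorem chart_relOpen (hc : ‖c‖ = 1) (hφc : Continuous φ) (hφ1 : ∀ u r, φ (u + 1, r) = φ (u, r))
    (hφp : ∀ p, φ p ∈ page g c) (hφi : InjOn φ (Ico (0 : ℝ) 1 ×ˢ Ioo (-1 : ℝ) 1))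
    {p₀ : ℝ × ℝ} (hp₀ : p₀.2 ∈ Ioo (-1 : ℝ) 1) {N : Set (ℝ × ℝ)} (hN : N ∈ 𝓝 p₀) :
    ∃ O ∈ 𝓝 (φ p₀), ∀ q ∈ O, q ∈ page g c → q ∈ φ '' N := by
  classical
  have ha0 : (φ p₀).1 ≠ 0 := page_val_ne_zero hc (hφp p₀)
  set f' : EuclideanSpace ℝ (Fin 4) →L[ℝ] ℂ := fderiv ℝ (w g) (φ p₀).1 with hf'_def
  have hf : HasStrictFDerivAt (w g) f' (φ p₀).1 :=
    (contDiff_w g).contDiffAt.hasStrictFDerivAt (by simp)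
  have hf' : LinearMap.range (f' : EuclideanSpace ℝ (Fin 4) →ₗ[ℝ] ℂ) = ⊤ :=
    LinearMap.range_eq_top.2 (fderiv_w_surjective ha0)
  set Θ := hf.implicitToOpenPartialHomeomorph (w g) f' hf' with hΘ_def
  have haΘ : (φ p₀).1 ∈ Θ.source := hf.mem_implicitToOpenPartialHomeomorph_source hf'
  have hΘfst : ∀ x, (Θ x).1 = w g x := fun x => hf.implicitToOpenPartialHomeomorph_fst hf' x
  -- the window around `p₀` on which `φ` is injective, cut down to the chart domain
  set W : Set (ℝ × ℝ) := Ioo (p₀.1 - 1 / 2) (p₀.1 + 1 / 2) ×ˢ Ioo (-1 : ℝ) 1 with hW_def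
  have hWo : IsOpen W := isOpen_Ioo.prod isOpen_Ioo
  have hp₀W : p₀ ∈ W := ⟨⟨by linarith, by linarith⟩, hp₀⟩
  have hinjW : InjOn φ W := chart_injOn_window hφ1 hφi p₀.1
  have hΦc : Continuous fun p : ℝ × ℝ => (φ p).1 := continuous_subtype_val.comp hφc
  set D : Set (ℝ × ℝ) := W ∩ (fun p : ℝ × ℝ => (φ p).1) ⁻¹' Θ.source with hD_def
  have hDo : IsOpen D := hWo.inter (Θ.open_source.preimage hΦc)
  have hp₀D : p₀ ∈ D := ⟨hp₀W, haΘ⟩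
  -- the page, straightened: `G = pr₂ ∘ Θ ∘ φ` is a continuous injection of `D ⊆ ℝ²` into the plane
  set G : ℝ × ℝ → LinearMap.ker (f' : EuclideanSpace ℝ (Fin 4) →ₗ[ℝ] ℂ) :=
    fun p => (Θ (φ p).1).2 with hG_def
  have hGc : ContinuousOn G D := by
    refine continuous_snd.comp_continuousOn ?_
    exact Θ.continuousOn.comp hΦc.continuousOn fun p hp => hp.2
  have hGinj : InjOn G D := by
    intro p hp p' hp' hG
    apply hinjW hp.1 hp'.1
    have h1 : Θ (φ p).1 = Θ (φ p').1 :=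
      Prod.ext (by rw [hΘfst, hΘfst, (hφp p).2, (hφp p').2]) hG
    exact Subtype.ext (Θ.injOn hp.2 hp'.2 h1)
  set N' : Set (ℝ × ℝ) := interior N ∩ D with hN'_def
  have hN'o : IsOpen N' := isOpen_interior.inter hDo
  have hp₀N' : p₀ ∈ N' := ⟨mem_interior_iff_mem_nhds.2 hN, hp₀D⟩
  have hdim : Module.finrank ℝ (ℝ × ℝ) =
      Module.finrank ℝ (LinearMap.ker (f' : EuclideanSpace ℝ (Fin 4) →ₗ[ℝ] ℂ)) := by
    rw [finrank_ker_eq_two hf', Module.finrank_prod, Module.finrank_self]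
  have hopen : IsOpen (G '' N') :=
    Literature.Topology.Euclidean.Brouwer.isOpen_image_of_injOn hdim hN'o
      (hGc.mono inter_subset_right) (hGinj.mono inter_subset_right)
  -- the neighbourhood of `φ p₀` in the base
  set S : Set (Base g) := Subtype.val ⁻¹' Θ.source with hS_def
  have hSo : IsOpen S := Θ.open_source.preimage continuous_subtype_val
  set F : Base g → LinearMap.ker (f' : EuclideanSpace ℝ (Fin 4) →ₗ[ℝ] ℂ) :=
    fun q => (Θ q.1).2 with hF_def
  have hFc : ContinuousOn F S :=
    continuous_snd.comp_continuousOn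
      (Θ.continuousOn.comp continuous_subtype_val.continuousOn fun q hq => hq)
  refine ⟨S ∩ F ⁻¹' (G '' N'), (hFc.isOpen_inter_preimage hSo hopen).mem_nhds
    ⟨haΘ, p₀, hp₀N', rfl⟩, ?_⟩
  rintro q ⟨hqS, p, hpN', hpq⟩ hq
  refine ⟨p, interior_subset hpN'.1, ?_⟩
  have h1 : Θ (φ p).1 = Θ q.1 := Prod.ext (by rw [hΘfst, hΘfst, (hφp p).2, hq.2]) hpq
  exact Subtype.ext (Θ.injOn hpN'.2.2 hqS h1)

/-! ## §3 Consequences: the open annulus pulls back to open sets; path lifting -/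

/-- **The open annulus `φ(ℝ × (−1, 1))` pulls back to an open set under every continuous map
into the page.** [folklore] -/
theorem isOpen_preimage_annulus (hc : ‖c‖ = 1) (hφc : Continuous φ)
    (hφ1 : ∀ u r, φ (u + 1, r) = φ (u, r)) (hφp : ∀ p, φ p ∈ page g c)
    (hφi : InjOn φ (Ico (0 : ℝ) 1 ×ˢ Ioo (-1 : ℝ) 1)) {Y : Type*} [TopologicalSpace Y]
    {γ : Y → Base g} (hγ : Continuous γ) (hγp : ∀ y, γ y ∈ page g c) :
    IsOpen (γ ⁻¹' (φ '' (univ ×ˢ Ioo (-1 : ℝ) 1))) := by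
  rw [isOpen_iff_mem_nhds]
  rintro y ⟨p, ⟨-, hp⟩, hpy⟩
  obtain ⟨O, hO, hOsub⟩ := chart_relOpen hc hφc hφ1 hφp hφi hp
    ((isOpen_univ.prod isOpen_Ioo).mem_nhds (⟨trivial, hp⟩ : p ∈ univ ×ˢ Ioo (-1 : ℝ) 1))
  rw [hpy] at hO
  filter_upwards [hγ.continuousAt.preimage_mem_nhds hO] with y' hy'
  exact hOsub _ hy' (hγp y')

/-- **Path lifting through an annulus chart.**  A map `γ`, continuous on `[t₁, t₂]` with values in
the open annulus `φ(ℝ × (−1, 1))`, lifts: `γ t = φ (u t, r t)` with `u`, `r` continuous on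
`[t₁, t₂]` and `r t ∈ (−1, 1)` (the multivalued inverse is continuous read through
`(u, r) ↦ e^{r + 2πiu}`, by relative openness; then take a continuous logarithm).
[cite: HatcherAT2002, §1.3 Prop. 1.30] -/
theorem exists_chart_lift (hc : ‖c‖ = 1) (hφc : Continuous φ)
    (hφ1 : ∀ u r, φ (u + 1, r) = φ (u, r)) (hφp : ∀ p, φ p ∈ page g c)
    (hφi : InjOn φ (Ico (0 : ℝ) 1 ×ˢ Ioo (-1 : ℝ) 1)) {γ : ℝ → Base g} {t₁ t₂ : ℝ}
    (hγ : ContinuousOn γ (Icc t₁ t₂))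
    (hγA : ∀ t ∈ Icc t₁ t₂, γ t ∈ φ '' (univ ×ˢ Ioo (-1 : ℝ) 1)) :
    ∃ u r : ℝ → ℝ, ContinuousOn u (Icc t₁ t₂) ∧ ContinuousOn r (Icc t₁ t₂) ∧
      ∀ t ∈ Icc t₁ t₂, r t ∈ Ioo (-1 : ℝ) 1 ∧ φ (u t, r t) = γ t := by
  classical
  let E : ℝ × ℝ → ℂ := fun p => Complex.exp ((p.2 : ℂ) + ((2 * π * p.1 : ℝ) : ℂ) * Complex.I)
  have hEc : Continuous E := by fun_prop
  have hA : ∀ t ∈ Icc t₁ t₂, ∃ p : ℝ × ℝ, p.2 ∈ Ioo (-1 : ℝ) 1 ∧ φ p = γ t := fun t ht => by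
    obtain ⟨p, ⟨-, hp⟩, hpt⟩ := hγA t ht
    exact ⟨p, hp, hpt⟩
  choose! P hP2 hPγ using hA
  -- `E` is constant on the fibres of `φ`
  have hEfib : ∀ p p' : ℝ × ℝ, p.2 ∈ Ioo (-1 : ℝ) 1 → p'.2 ∈ Ioo (-1 : ℝ) 1 → φ p = φ p' →
      E p = E p' := by
    intro p p' hp hp' h
    obtain ⟨h2, n, hn⟩ := chart_eq_iff hφ1 hφi hp hp' h
    simp only [E, h2, hn]
    rw [Complex.exp_eq_exp_iff_exists_int]
    exact ⟨-n, by push_cast; ring⟩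
  -- continuity of `E ∘ P` on the interval
  have hψc : ContinuousOn (fun t => E (P t)) (Icc t₁ t₂) := by
    intro t₀ ht₀
    rw [ContinuousWithinAt, Metric.tendsto_nhds]
    intro ε hε
    have hN : E ⁻¹' ball (E (P t₀)) ε ∩ univ ×ˢ Ioo (-1 : ℝ) 1 ∈ 𝓝 (P t₀) :=
      inter_mem (hEc.continuousAt.preimage_mem_nhds (ball_mem_nhds _ hε))
        ((isOpen_univ.prod isOpen_Ioo).mem_nhds ⟨trivial, hP2 t₀ ht₀⟩)
    obtain ⟨O, hO, hOsub⟩ := chart_relOpen hc hφc hφ1 hφp hφi (hP2 t₀ ht₀) hN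
    rw [hPγ t₀ ht₀] at hO
    filter_upwards [(hγ t₀ ht₀).preimage_mem_nhdsWithin hO, self_mem_nhdsWithin] with t ht htI
    have hpage : γ t ∈ page g c := by
      obtain ⟨p, -, hp⟩ := hγA t htI
      rw [← hp]; exact hφp p
    obtain ⟨p, ⟨hpε, -, hp2⟩, hpt⟩ := hOsub (γ t) ht hpage
    show dist (E (P t)) (E (P t₀)) < ε
    rw [hEfib (P t) p (hP2 t htI) hp2 ((hPγ t htI).trans hpt.symm)]
    exact hpε
  obtain ⟨l, hlc, hle⟩ := Literature.Topology.PlaneTopology.hasLogOn_Icc hψc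
    (fun t _ => Complex.exp_ne_zero _)
  refine ⟨fun t => (l t).im / (2 * π), fun t => (l t).re,
    (Complex.continuous_im.comp_continuousOn hlc).div_const _,
    Complex.continuous_re.comp_continuousOn hlc, fun t ht => ?_⟩
  obtain ⟨n, hn⟩ := Complex.exp_eq_exp_iff_exists_int.1 (hle t ht)
  have hre : (l t).re = (P t).2 := by
    rw [hn]; simp
  have him : (l t).im / (2 * π) = (P t).1 + n := by
    rw [hn]
    simp only [Complex.add_im, Complex.ofReal_im, Complex.mul_im, Complex.ofReal_re,
      Complex.I_re, Complex.I_im, Complex.ofReal_im, mul_zero, mul_one, zero_add,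
      Complex.intCast_im, Complex.intCast_re, Complex.mul_re, Complex.re_ofNat,
      Complex.im_ofNat, sub_zero, zero_mul, add_zero]
    field_simp
  constructor
  · show (l t).re ∈ Ioo (-1 : ℝ) 1
    rw [hre]
    exact hP2 t ht
  · show φ ((l t).im / (2 * π), (l t).re) = γ t
    rw [him, hre, chart_periodic_int hφ1 n, Prod.mk.eta]
    exact hPγ t ht

/-- **Sub-goal `helper_annulusChart_lift`** (N1a of NF4, file 1): path lifting through an annulus
chart of a page of the Lefschetz base, in registered form. [cite: HatcherAT2002, §1.3 Prop. 1.30] -/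
theorem helper_annulusChart_lift : ∀ (g : ℕ) (c : ℂ) (φ : ℝ × ℝ → Literature.Topology.FourManifolds.LefschetzBase.Base g) (γ : ℝ → Literature.Topology.FourManifolds.LefschetzBase.Base g) (t₁ t₂ : ℝ), ‖c‖ = 1 → Continuous φ → (∀ u r, φ (u + 1, r) = φ (u, r)) → (∀ p, φ p ∈ Literature.Topology.FourManifolds.LefschetzBase.page g c) → Set.InjOn φ (Set.Ico (0 : ℝ) 1 ×ˢ Set.Ioo (-1 : ℝ) 1) → ContinuousOn γ (Set.Icc t₁ t₂) → (∀ t ∈ Set.Icc t₁ t₂, γ t ∈ φ '' (Set.univ ×ˢ Set.Ioo (-1 : ℝ) 1)) → ∃ u r : ℝ → ℝ, ContinuousOn u (Set.Icc t₁ t₂) ∧ ContinuousOn r (Set.Icc t₁ t₂) ∧ ∀ t ∈ Set.Icc t₁ t₂, r t ∈ Set.Ioo (-1 : ℝ) 1 ∧ φ (u t, r t) = γ t :=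
  fun _ _ _ _ _ _ hc hφc hφ1 hφp hφi hγ hγA => exists_chart_lift hc hφc hφ1 hφp hφi hγ hγA

end Summit.SmoothPoincare4.SmoothPoincare4.Theorems.AcyclicBisectionExists.ModpBraidOrbits

end
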